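import Mathlib.Data.EReal.Basic
import Mathlib.LinearAlgebra.Basis.Defs
import Literature.Barriers.MatrixMultiplication.TricoloredSumFreeBarrierProofs
import Literature.Barriers.MatrixMultiplication.UniversalMethodBarrierSliceRank
import Literature.Computability.Complexity.SamplingChernoff
import HarnessLib

/-!
# Unstable tensors and slice rank (Blasiak–Church–Cohn–Grochow–Naslund–Sawin–Umans 2017, §4.2–4.3)

Source: J. Blasiak, T. Church, H. Cohn, J. A. Grochow, E. Naslund, W. F. Sawin, C. Umans, *On cap sets
and the group-theoretic approach to matrix multiplication*, Discrete Analysis 2017:3, arXiv:1605.06702,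
§4.2 "Unstable tensors and slice rank" and §4.3 "Upper bounds on slice rank". This is the part of the
paper announced in its abstract as "a variant of tensor rank due to Tao gives a quantitative
understanding of the notion of unstable tensor from geometric invariant theory", and the only part
not yet in the tree: Thms. A, A′, B, 4.14 are `Literature.Barriers.MatrixMultiplication.BCCGNSU2017_thmA`
/ `…_thmA'` / `…_thm414` (all discharged, `TricoloredSumFreeBarrierProofs.lean`) and
`BCCGNSU2017_thmB_explicit` (`TricoloredSumFreeBarrierEffective.lean`); §2–§3 and Lemma 4.7,
Props. 4.2, 4.8, 4.12, 4.15, the rate function `J` of (4.10) (`bccgnsuJ`) live in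
`Literature/Combinatorics/Additive/{SliceRankMethod, BorderTricoloredSumFree, TricoloredSumFreeBound,
TricoloredSumFreeLowerBound}.lean`; Rem. 4.9 (the slice rank of `⟨n,n,n⟩` is `n²`) is the tree's
`le_sliceRank_matMulDirectSum` (`SliceRankAntichain.lean`). Statements first (D-0064: one file
for the section); vocabulary = the tree's `sliceRank` (`UniversalMethodBarrier.lean`),
`HasSliceRankLE` (`SliceRankMethod.lean`), `kroneckerPow` (`AsymptoticSpectrum.lean`), `bccgnsuJ`.

## Source item → Lean declaration → status

| BCCGNSU 2017 | declaration | status |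
|---|---|---|
| Def. 4.3 (unstable function `F : X × Y × Z → 𝔽`, via bases and real weights) | `IsWeightUnstable` | definition |
| Def. 4.4 (the condition "`F = Σ_{u_a+v_b+w_c ≤ R} r_{abc} f_a g_b h_c`, `R = avg − ε·(ranges)`, nontrivial weights") | `IsEpsUnstable` | definition; antitone in `ε` (`IsEpsUnstable.anti`) |
| Def. 4.4 (instability = the supremum of such `ε ≥ 0`, `−∞` if none) | `instability` | definition (`EReal`-valued) |
| Thm. 4.6 (`slicerank F < min(|X|,|Y|,|Z|) ⇒ F` unstable) | `BCCGNSU2017_thm46` | named fact, PROVED (`BCCGNSU2017_thm46_holds`) |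
| Thm. 4.10 (`F` unstable `⇒ slicerank(F^{⊗n}) ≤ (|X|ⁿ+|Y|ⁿ+|Z|ⁿ) e^{−2n·instability(F)²}`) | `BCCGNSU2017_thm410` | named fact (for every admissible `ε`, as its proof shows; see the docstring), PROVED (`BCCGNSU2017_thm410_holds`); printed supremum form PROVED (`sliceRank_kroneckerPow_le_exp_instability`) |
| eq. (4.9) (triangle rank at most `k`) | `HasTriangleRankLE` | definition |
| Prop. 4.13 (`|X|=|Y|=|Z|=k`, `trianglerank F ≤ k ⇒ instability(F) ≥ 1/6` and `slicerank(F^{⊗n}) ≤ 3(kJ(k))ⁿ`) | `BCCGNSU2017_prop413` | named fact, PROVED (`BCCGNSU2017_prop413_holds`) |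

## Design notes

* Index sets of bases. Def. 4.3 asks for "a basis `{f_a}` for the functions `X → 𝔽`" with an
  unspecified index set; any such basis has `|X|` elements, and the unstable/`ε`-unstable conditions
  are invariant under re-indexing the basis together with its weights, so we index the three bases
  by `X`, `Y`, `Z` themselves (`Basis X K (X → K)` etc.). This loses nothing (Rem. 4.5 (3) even
  allows arbitrary spanning families). [cite: BlasiakChurchCohnGrochowNaslundSawinUmans2017, Rem. 4.5]
* "`F = Σ_{u_a+v_b+w_c < u_avg+v_avg+w_avg} r_{abc} f_a(x) g_b(y) h_c(z)`" is written as: `F` is the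
  full triple sum with a coefficient tensor `r` SUPPORTED on the admissible triples
  (`r a b c ≠ 0 → u a + v b + w c < …`), which is the same statement.
* Ranges `u_max − u_min` are `(⨆ a, u a) − (⨅ a, u a)` (finite index types; on an empty index type
  both are Lean's `sSup ∅ = 0`, an irrelevant junk case since then the tensor format is empty).
* Thm. 4.10 is printed with `instability(F)` (a supremum) in the exponent; its proof ("It suffices to
  prove for all `ε < instability(F)` that `slicerank(F^{⊗n}) ≤ (|X|ⁿ+|Y|ⁿ+|Z|ⁿ)e^{−2nε²}`. Given such
  an `ε`, we can choose functions … as in Definition 4.4") establishes the bound for every admissible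
  `ε ≥ 0`, which is the form vendored (`BCCGNSU2017_thm410`); the printed form follows by taking the
  supremum (the left side is an integer, the right side is continuous in `ε`).
* Prop. 4.13 is vendored for `k ≥ 2`: `J(s)` is defined for `s > 1` only ((4.10)), and for `k = 1` no
  nontrivial weights exist, so the printed "instability `≥ 1/6`" silently assumes `k ≥ 2`.

WHAT THIS IS NOT: no statement about `ω`; the application to `D_{(ℤ/q)ⁿ}` (Thm. 4.14, Thms. A/A′/B)
is already in the tree and is not restated.
-/

noncomputable section

open scoped BigOperators

open Literature.Barriers.MatrixMultiplication (sliceRank bccgnsuJ)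

namespace Literature.Computability.AlgebraicComplexity

universe u v₁ v₂ v₃

section Defs

variable {K : Type u} [Field K] {X : Type v₁} {Y : Type v₂} {Z : Type v₃}
  [Fintype X] [Fintype Y] [Fintype Z]

/-- The **range** `u_max − u_min` of a real weight vector on a finite index set (BCCGNSU 2017,
Def. 4.4, the quantity `u_max − u_min` in (4.6)); junk `0` on an empty index type.
[cite: BlasiakChurchCohnGrochowNaslundSawinUmans2017, Def. 4.4] -/
def weightRange {ι : Type*} (u : ι → ℝ) : ℝ := (⨆ a, u a) - ⨅ a, u a

/-- The range of a weight vector on a finite index set is nonnegative.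
[cite: BlasiakChurchCohnGrochowNaslundSawinUmans2017, Def. 4.4] -/
theorem weightRange_nonneg {ι : Type*} [Finite ι] (u : ι → ℝ) : 0 ≤ weightRange u := by
  unfold weightRange
  rcases isEmpty_or_nonempty ι with hι | hι
  · simp [Real.iSup_of_isEmpty, Real.iInf_of_isEmpty]
  · obtain ⟨a⟩ := hι
    have h1 : (⨅ a, u a) ≤ u a := ciInf_le (Finite.bddBelow_range u) a
    have h2 : u a ≤ ⨆ a, u a := le_ciSup (Finite.bddAbove_range u) a
    linarith

/-- **Unstable function** (BCCGNSU 2017, Def. 4.3): "`F : X × Y × Z → 𝔽` is *unstable* if there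
exist a basis `{f_a}` for the functions `X → 𝔽`, and similarly bases `{g_b : Y → 𝔽}` and
`{h_c : Z → 𝔽}`, weights `u_a, v_b, w_c ∈ ℝ` with arithmetic means `u_avg, v_avg, w_avg`, and
coefficients `r_{a,b,c} ∈ 𝔽` such that
`F(x,y,z) = Σ_{u_a+v_b+w_c < u_avg+v_avg+w_avg} r_{a,b,c} f_a(x) g_b(y) h_c(z)`" (over an
algebraically closed field this is GIT-instability, by the Hilbert–Mumford criterion; for general `𝔽`
it is taken as the definition). Bases are indexed by `X`, `Y`, `Z` themselves (module docstring).
[cite: BlasiakChurchCohnGrochowNaslundSawinUmans2017, Def. 4.3] -/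
def IsWeightUnstable (F : X → Y → Z → K) : Prop :=
  ∃ (f : Module.Basis X K (X → K)) (g : Module.Basis Y K (Y → K)) (h : Module.Basis Z K (Z → K))
    (u : X → ℝ) (v : Y → ℝ) (w : Z → ℝ) (r : X → Y → Z → K),
    (∀ a b c, r a b c ≠ 0 →
      u a + v b + w c < (∑ a, u a) / Fintype.card X + (∑ b, v b) / Fintype.card Y +
        (∑ c, w c) / Fintype.card Z) ∧
    ∀ x y z, F x y z = ∑ a, ∑ b, ∑ c, r a b c * (f a x * g b y * h c z)

/-- **`ε`-instability condition** (BCCGNSU 2017, Def. 4.4): there exist bases `f_a, g_b, h_c`,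
NONTRIVIAL weights `u_a, v_b, w_c ∈ ℝ` ("the weights should not all be constant") and coefficients
`r_{a,b,c} ∈ 𝔽` with `F(x,y,z) = Σ_{u_a+v_b+w_c ≤ R} r_{a,b,c} f_a(x) g_b(y) h_c(z)` (4.5), where
`R = (u_avg + v_avg + w_avg) − ε (u_max − u_min + v_max − v_min + w_max − w_min)` (4.6). The
instability of `F` is the supremum of the `ε ≥ 0` satisfying this (`instability`).
[cite: BlasiakChurchCohnGrochowNaslundSawinUmans2017, Def. 4.4] -/
def IsEpsUnstable (F : X → Y → Z → K) (ε : ℝ) : Prop :=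
  ∃ (f : Module.Basis X K (X → K)) (g : Module.Basis Y K (Y → K)) (h : Module.Basis Z K (Z → K))
    (u : X → ℝ) (v : Y → ℝ) (w : Z → ℝ) (r : X → Y → Z → K),
    ¬ ((∀ a a', u a = u a') ∧ (∀ b b', v b = v b') ∧ (∀ c c', w c = w c')) ∧
    (∀ a b c, r a b c ≠ 0 →
      u a + v b + w c ≤ (∑ a, u a) / Fintype.card X + (∑ b, v b) / Fintype.card Y +
        (∑ c, w c) / Fintype.card Z - ε * (weightRange u + weightRange v + weightRange w)) ∧
    ∀ x y z, F x y z = ∑ a, ∑ b, ∑ c, r a b c * (f a x * g b y * h c z)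

/-- **Instability** of `F` (BCCGNSU 2017, Def. 4.4): "the supremum of all `ε ≥ 0` such that there
exist bases, nontrivial weights, and coefficients" as in `IsEpsUnstable`; "by convention, if for some
`F` there is no nonnegative `ε` satisfying the hypotheses of the definition, we define
`instability(F) = −∞`" — hence valued in `EReal` (`sSup ∅ = ⊥`).
[cite: BlasiakChurchCohnGrochowNaslundSawinUmans2017, Def. 4.4] -/
def instability (F : X → Y → Z → K) : EReal :=
  sSup ((fun ε : ℝ => (ε : EReal)) '' {ε : ℝ | 0 ≤ ε ∧ IsEpsUnstable F ε})

/-- The `ε`-instability condition is antitone in `ε`: the cut-off `R` of (4.6) only grows as `ε`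
decreases (the ranges are nonnegative), so an admissible decomposition for `ε` is admissible for
every `ε' ≤ ε`. [cite: BlasiakChurchCohnGrochowNaslundSawinUmans2017, Def. 4.4] -/
theorem IsEpsUnstable.anti {F : X → Y → Z → K} {ε ε' : ℝ} (h : IsEpsUnstable F ε) (hε : ε' ≤ ε) :
    IsEpsUnstable F ε' := by
  obtain ⟨f, g, hb, u, v, w, r, hnt, hr, hF⟩ := h
  refine ⟨f, g, hb, u, v, w, r, hnt, fun a b c habc => ?_, hF⟩
  have hR : 0 ≤ weightRange u + weightRange v + weightRange w := by
    have := weightRange_nonneg u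
    have := weightRange_nonneg v
    have := weightRange_nonneg w
    linarith
  have := hr a b c habc
  nlinarith

/-- An admissible `ε ≥ 0` bounds the instability from below.
[cite: BlasiakChurchCohnGrochowNaslundSawinUmans2017, Def. 4.4] -/
theorem le_instability_of_isEpsUnstable {F : X → Y → Z → K} {ε : ℝ} (hε : 0 ≤ ε)
    (h : IsEpsUnstable F ε) : (ε : EReal) ≤ instability F :=
  le_sSup ⟨ε, ⟨hε, h⟩, rfl⟩

omit [Fintype X] [Fintype Y] [Fintype Z] in
/-- **Triangle rank at most `k`** (BCCGNSU 2017, (4.9): "the *triangle rank* `trianglerank(F)` [is]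
the smallest `k` for which there exist functions `f_a`, `g_b`, `h_c` for `a, b, c ∈ {0, …, k−1}` such
that `F(x,y,z) = Σ_{a+b+c<k} r_{a,b,c} f_a(x) g_b(y) h_c(z)`"; the functions need not be independent).
[cite: BlasiakChurchCohnGrochowNaslundSawinUmans2017, (4.9)] -/
def HasTriangleRankLE (F : X → Y → Z → K) (k : ℕ) : Prop :=
  ∃ (f : Fin k → X → K) (g : Fin k → Y → K) (h : Fin k → Z → K) (r : Fin k → Fin k → Fin k → K),
    ∀ x y z, F x y z =
      ∑ a : Fin k, ∑ b : Fin k, ∑ c : Fin k,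
        if (a : ℕ) + (b : ℕ) + (c : ℕ) < k then r a b c * (f a x * g b y * h c z) else 0

omit [Fintype X] [Fintype Y] [Fintype Z] in
/-- The zero function has triangle rank `≤ k` for every `k` (all coefficients zero).
[cite: BlasiakChurchCohnGrochowNaslundSawinUmans2017, (4.9)] -/
theorem hasTriangleRankLE_zero (k : ℕ) : HasTriangleRankLE (fun (_ : X) (_ : Y) (_ : Z) => (0 : K)) k :=
  ⟨fun _ _ => 0, fun _ _ => 0, fun _ _ => 0, fun _ _ _ => 0, fun x y z => by simp⟩

end Defs

/-! ## Named facts -/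

section Facts

/-- **BCCGNSU 2017, Theorem 4.6** ("If `slicerank(F) < min(|X|, |Y|, |Z|)`, then `F` is unstable").
Printed proof: from a slice decomposition with `p + q + r = slicerank(F)` pieces, extend the
(independent) slice functions to bases and give them weight `−1`, all other basis vectors weight `0`;
then every term has weight `≤ −1 < −(p/|X| + q/|Y| + r/|Z|) = u_avg + v_avg + w_avg`. Hence a
tensor that is not unstable has full slice rank `min(|X|,|Y|,|Z|)` (used for Lemma 4.7 and Rem. 4.9).
Known theorem; statement only. [cite: BlasiakChurchCohnGrochowNaslundSawinUmans2017, Thm. 4.6] -/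
def BCCGNSU2017_thm46 : Prop :=
  ∀ {K : Type} [Field K] {X Y Z : Type} [Fintype X] [Fintype Y] [Fintype Z]
    (F : X → Y → Z → K),
    sliceRank F < min (Fintype.card X) (min (Fintype.card Y) (Fintype.card Z)) → IsWeightUnstable F

/-- **BCCGNSU 2017, Theorem 4.10** ("If `F` is unstable, then for any `n ≥ 1`,
`slicerank(F^{⊗n}) ≤ (|X|ⁿ + |Y|ⁿ + |Z|ⁿ) e^{−2n·instability(F)²}`"), in the form its proof
establishes: for every `ε ≥ 0` for which `F` admits an `ε`-unstable decomposition (Def. 4.4) and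
every `n ≥ 1`, `slicerank(F^{⊗n}) ≤ (|X|ⁿ + |Y|ⁿ + |Z|ⁿ) e^{−2nε²}` (group the product-basis
expansion of `F^{⊗n}` by which of the three summed weights is `≤ n·(its bound)`, and count the
low-weight tuples by Hoeffding's inequality). `F^{⊗n}` is the tree's `kroneckerPow F n`. The printed
form with `instability(F)` follows by letting `ε ↑ instability(F)`. Known theorem; statement only.
[cite: BlasiakChurchCohnGrochowNaslundSawinUmans2017, Thm. 4.10] -/
def BCCGNSU2017_thm410 : Prop :=
  ∀ {K : Type} [Field K] {X Y Z : Type} [Fintype X] [Fintype Y] [Fintype Z]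
    (F : X → Y → Z → K), IsWeightUnstable F → ∀ ε : ℝ, 0 ≤ ε → IsEpsUnstable F ε →
    ∀ n : ℕ, 1 ≤ n →
      (sliceRank (kroneckerPow F n) : ℝ) ≤
        ((Fintype.card X : ℝ) ^ n + (Fintype.card Y : ℝ) ^ n + (Fintype.card Z : ℝ) ^ n) *
          Real.exp (-2 * n * ε ^ 2)

/-- **BCCGNSU 2017, Proposition 4.13** ("If `|X| = |Y| = |Z| = k` and `trianglerank(F) ≤ k`, then not
only is `instability(F) ≥ 1/6`, but moreover the slice rank of `F^{⊗n}` is at most `3(kJ(k))ⁿ`"),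
with `J` the rate function of (4.10) (`bccgnsuJ`) and the first claim in the form its proof gives
(an admissible decomposition with `ε = 1/6`: weights `u_a = a`, `R = k − 1`). Vendored for `k ≥ 2`
(for `k = 1` no nontrivial weights exist and `J(1)` is not defined in print). Known theorem;
statement only. [cite: BlasiakChurchCohnGrochowNaslundSawinUmans2017, Prop. 4.13] -/
def BCCGNSU2017_prop413 : Prop :=
  ∀ {K : Type} [Field K] {X Y Z : Type} [Fintype X] [Fintype Y] [Fintype Z] (k : ℕ), 2 ≤ k →
    Fintype.card X = k → Fintype.card Y = k → Fintype.card Z = k →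
    ∀ F : X → Y → Z → K, HasTriangleRankLE F k →
      IsEpsUnstable F (1 / 6) ∧
        ∀ n : ℕ, (sliceRank (kroneckerPow F n) : ℝ) ≤ 3 * ((k : ℝ) * bccgnsuJ k) ^ n

/-- Thm. 4.10 for an admissible `ε` gives the printed instability-exponent bound along any
`ε ≤ ε₀` as well (monotonicity of the admissible set, `IsEpsUnstable.anti`): a corollary packaging
how the fact is consumed with a smaller, explicit `ε`.
[cite: BlasiakChurchCohnGrochowNaslundSawinUmans2017, Thm. 4.10] -/
theorem BCCGNSU2017_thm410.of_le (h410 : BCCGNSU2017_thm410) {K : Type} [Field K] {X Y Z : Type}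
    [Fintype X] [Fintype Y] [Fintype Z] (F : X → Y → Z → K) (hF : IsWeightUnstable F)
    {ε₀ ε : ℝ} (hε : 0 ≤ ε) (hle : ε ≤ ε₀) (h₀ : IsEpsUnstable F ε₀) (n : ℕ) (hn : 1 ≤ n) :
    (sliceRank (kroneckerPow F n) : ℝ) ≤
      ((Fintype.card X : ℝ) ^ n + (Fintype.card Y : ℝ) ^ n + (Fintype.card Z : ℝ) ^ n) *
        Real.exp (-2 * n * ε ^ 2) :=
  h410 F hF ε hε (h₀.anti hle) n hn

end Facts

/-! ## Proof of Thm. 4.6 (the printed argument: adapted bases, weights `−1`/`0`) -/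

section Thm46Proof

open Module

variable {K : Type u} [Field K]

/-- Pointwise expansion of a function in a basis of the function space:
`φ(x) = Σ_a [φ]_a f_a(x)`. [cite: BlasiakChurchCohnGrochowNaslundSawinUmans2017, Thm. 4.6 (proof)] -/
private theorem apply_eq_sum_repr_mul {ι : Type*} [Fintype ι] (f : Basis ι K (ι → K)) (φ : ι → K)
    (x : ι) : φ x = ∑ a, f.repr φ a * f a x := by
  have h := congrFun (f.sum_repr φ) x
  simpa [Finset.sum_apply, Pi.smul_apply, smul_eq_mul] using h.symm

/-- Coordinates of a pointwise sum of three functions.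
[cite: BlasiakChurchCohnGrochowNaslundSawinUmans2017, Thm. 4.6 (proof)] -/
private theorem repr_apply_of_eq_add₃ {ι : Type*} [Fintype ι] (f : Basis ι K (ι → K)) (a : ι)
    (S P Q R : ι → K) (hS : ∀ x, S x = P x + Q x + R x) :
    f.repr S a = f.repr P a + f.repr Q a + f.repr R a := by
  have h : S = P + Q + R := funext fun x => by simpa using hS x
  rw [h, map_add, map_add, Finsupp.add_apply, Finsupp.add_apply]

/-- Coordinates of `x ↦ Σ_r α_r φ_r(x)` are `Σ_r α_r [φ_r]_a`.
[cite: BlasiakChurchCohnGrochowNaslundSawinUmans2017, Thm. 4.6 (proof)] -/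
private theorem repr_fun_sum_mul {ι : Type*} [Fintype ι] (f : Basis ι K (ι → K)) (a : ι)
    {ρ : Type*} [Fintype ρ] (α : ρ → K) (φ : ρ → ι → K) :
    f.repr (fun x => ∑ r, α r * φ r x) a = ∑ r, α r * f.repr (φ r) a := by
  have h : (fun x => ∑ r, α r * φ r x) = ∑ r, α r • φ r := by
    funext x; simp [Finset.sum_apply, Pi.smul_apply, smul_eq_mul]
  rw [h, map_sum, Finsupp.finsetSum_apply]
  refine Finset.sum_congr rfl fun r _ => ?_
  rw [map_smul, Finsupp.smul_apply, smul_eq_mul]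

/-- `x ↦ Σ_r φ_r(x) α_r` lies in the span of the `φ_r` (the `x`-slices of the first summand of a
slice decomposition lie in the span of its slice functions).
[cite: BlasiakChurchCohnGrochowNaslundSawinUmans2017, Thm. 4.6 (proof)] -/
private theorem fun_sum_mul_mem_span {ι : Type*} {ρ : Type*} [Fintype ρ] (φ : ρ → ι → K)
    (α : ρ → K) : (fun x => ∑ r, φ r x * α r) ∈ Submodule.span K (Set.range φ) := by
  have h : (fun x => ∑ r, φ r x * α r) = ∑ r, α r • φ r := by
    funext x; simp [Finset.sum_apply, Pi.smul_apply, smul_eq_mul, mul_comm]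
  rw [h]
  exact Submodule.sum_mem _ fun r _ => Submodule.smul_mem _ _ (Submodule.subset_span ⟨r, rfl⟩)

/-- **Adapted basis** (the step "extend them to a basis" of the printed proof, in the form of
Rem. 4.5 (3)): for a subspace `U` of `K^ι` there is a basis of `K^ι` indexed by `ι` and a set `A` of
`dim U` indices such that every vector of `U` has vanishing coordinates outside `A`.
[cite: BlasiakChurchCohnGrochowNaslundSawinUmans2017, Thm. 4.6 (proof) and Rem. 4.5 (3)] -/
private theorem exists_adapted_basis {ι : Type*} [Fintype ι] (U : Submodule K (ι → K)) :
    ∃ (b : Basis ι K (ι → K)) (A : Finset ι), A.card = finrank K U ∧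
      ∀ φ ∈ U, ∀ a, a ∉ A → b.repr φ a = 0 := by
  classical
  obtain ⟨W, hUW⟩ := U.exists_isCompl
  let e := Submodule.prodEquivOfIsCompl U W hUW
  let bU := Module.finBasis K U
  let bW := Module.finBasis K W
  let b' : Basis (Fin (finrank K U) ⊕ Fin (finrank K W)) K (ι → K) := (bU.prod bW).map e
  let σ := b'.indexEquiv (Pi.basisFun K ι)
  refine ⟨b'.reindex σ, Finset.univ.map ⟨fun i => σ (Sum.inl i), fun i j h => by simpa using h⟩,
    by simp, ?_⟩
  intro φ hφ a ha
  rw [Basis.repr_reindex_apply]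
  obtain ⟨j, hj⟩ : ∃ j, σ.symm a = Sum.inr j := by
    rcases h : σ.symm a with i | j
    · refine absurd (Finset.mem_map.2 ⟨i, Finset.mem_univ _, ?_⟩) ha
      show σ (Sum.inl i) = a
      rw [← h, Equiv.apply_symm_apply]
    · exact ⟨j, rfl⟩
  rw [hj]
  have hsymm : e.symm φ = ((⟨φ, hφ⟩ : ↥U), 0) :=
    Submodule.prodEquivOfIsCompl_symm_apply_left U W hUW ⟨φ, hφ⟩
  show (bU.prod bW).repr (e.symm φ) (Sum.inr j) = 0
  rw [hsymm, Basis.prod_repr_inr]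
  simp

/-- Sum of the `−1`/`0` weights attached to a set `A` of indices is `−|A|`.
[cite: BlasiakChurchCohnGrochowNaslundSawinUmans2017, Thm. 4.6 (proof)] -/
private theorem sum_negIndicator {ι : Type*} [Fintype ι] [DecidableEq ι] (A : Finset ι) :
    (∑ a, (if a ∈ A then (-1 : ℝ) else 0)) = -(A.card : ℝ) := by
  rw [Finset.sum_ite_mem, Finset.univ_inter, Finset.sum_const, nsmul_eq_mul, mul_neg, mul_one]

/-- **BCCGNSU 2017, Theorem 4.6, proved** (the printed proof: take a slice decomposition with
`p + q + r = slicerank(F)` pieces; choose bases of `K^X`, `K^Y`, `K^Z` adapted to the spans of the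
three families of slice functions, with weight `−1` on the adapted part and `0` elsewhere; every
product-basis coefficient of `F` then has weight `≤ −1`, while
`u_avg + v_avg + w_avg ≥ −(p+q+r)/min(|X|,|Y|,|Z|) > −1`).
[cite: BlasiakChurchCohnGrochowNaslundSawinUmans2017, Thm. 4.6] -/
theorem BCCGNSU2017_thm46_holds : BCCGNSU2017_thm46 := by
  intro K _ X Y Z _ _ _ F hlt
  classical
  obtain ⟨kx, ky, kz, hk, f₁, g₁, f₂, g₂, f₃, g₃, hD⟩ :=
    Literature.Barriers.MatrixMultiplication.hasSliceRankLE_sliceRank F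
  -- adapted bases for the three spans of slice functions
  obtain ⟨f, A, hA, hfA⟩ := exists_adapted_basis (K := K) (Submodule.span K (Set.range f₁))
  obtain ⟨g, B, hB, hgB⟩ := exists_adapted_basis (K := K) (Submodule.span K (Set.range f₂))
  obtain ⟨h, C, hC, hhC⟩ := exists_adapted_basis (K := K) (Submodule.span K (Set.range f₃))
  have hAk : A.card ≤ kx := by
    rw [hA]; simpa [Set.finrank] using finrank_range_le_card (R := K) f₁
  have hBk : B.card ≤ ky := by
    rw [hB]; simpa [Set.finrank] using finrank_range_le_card (R := K) f₂
  have hCk : C.card ≤ kz := by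
    rw [hC]; simpa [Set.finrank] using finrank_range_le_card (R := K) f₃
  refine ⟨f, g, h, fun a => if a ∈ A then -1 else 0, fun b => if b ∈ B then -1 else 0,
    fun c => if c ∈ C then -1 else 0,
    fun a b c => h.repr (fun z => g.repr (fun y => f.repr (fun x => F x y z) a) b) c, ?_, ?_⟩
  · -- support of the coefficient tensor ⇒ weight condition
    intro a b c hr
    -- (1) at least one index is adapted, or the coefficient vanishes
    have key : a ∈ A ∨ b ∈ B ∨ c ∈ C := by
      by_contra hcon
      simp only [not_or] at hcon
      obtain ⟨ha, hb, hc⟩ := hcon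
      apply hr
      show h.repr (fun z => g.repr (fun y => f.repr (fun x => F x y z) a) b) c = 0
      -- the `x`-coordinates of `F(·, y, z)` at `a ∉ A`
      have s1 : ∀ y z, f.repr (fun x => F x y z) a =
          (∑ r, f₂ r y * f.repr (fun x => g₂ r x z) a) +
            ∑ r, f₃ r z * f.repr (fun x => g₃ r x y) a := by
        intro y z
        have e0 := repr_apply_of_eq_add₃ f a (fun x => F x y z) (fun x => ∑ r, f₁ r x * g₁ r y z)
          (fun x => ∑ r, f₂ r y * g₂ r x z) (fun x => ∑ r, f₃ r z * g₃ r x y) (fun x => hD x y z)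
        have t1 : f.repr (fun x => ∑ r, f₁ r x * g₁ r y z) a = 0 :=
          hfA _ (fun_sum_mul_mem_span f₁ (fun r => g₁ r y z)) a ha
        have t2 : f.repr (fun x => ∑ r, f₂ r y * g₂ r x z) a =
            ∑ r, f₂ r y * f.repr (fun x => g₂ r x z) a :=
          repr_fun_sum_mul f a (fun r => f₂ r y) (fun r x => g₂ r x z)
        have t3 : f.repr (fun x => ∑ r, f₃ r z * g₃ r x y) a =
            ∑ r, f₃ r z * f.repr (fun x => g₃ r x y) a :=
          repr_fun_sum_mul f a (fun r => f₃ r z) (fun r x => g₃ r x y)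
        rw [e0, t1, t2, t3, zero_add]
      -- the `y`-coordinates at `b ∉ B`
      have s2 : ∀ z, g.repr (fun y => f.repr (fun x => F x y z) a) b =
          ∑ r, f₃ r z * g.repr (fun y => f.repr (fun x => g₃ r x y) a) b := by
        intro z
        have e1 : (fun y => f.repr (fun x => F x y z) a) =
            (fun y => ∑ r, f₂ r y * f.repr (fun x => g₂ r x z) a) +
              fun y => ∑ r, f₃ r z * f.repr (fun x => g₃ r x y) a := by
          funext y; rw [Pi.add_apply, s1 y z]
        have t1 : g.repr (fun y => ∑ r, f₂ r y * f.repr (fun x => g₂ r x z) a) b = 0 :=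
          hgB _ (fun_sum_mul_mem_span f₂ (fun r => f.repr (fun x => g₂ r x z) a)) b hb
        have t2 : g.repr (fun y => ∑ r, f₃ r z * f.repr (fun x => g₃ r x y) a) b =
            ∑ r, f₃ r z * g.repr (fun y => f.repr (fun x => g₃ r x y) a) b :=
          repr_fun_sum_mul g b (fun r => f₃ r z) (fun r y => f.repr (fun x => g₃ r x y) a)
        rw [e1, map_add, Finsupp.add_apply, t1, t2, zero_add]
      -- the `z`-coordinates at `c ∉ C`
      have e2 : (fun z => g.repr (fun y => f.repr (fun x => F x y z) a) b) =
          fun z => ∑ r, f₃ r z * g.repr (fun y => f.repr (fun x => g₃ r x y) a) b := by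
        funext z; exact s2 z
      rw [e2]
      exact hhC _ (fun_sum_mul_mem_span f₃
        (fun r => g.repr (fun y => f.repr (fun x => g₃ r x y) a) b)) c hc
    -- (2) the weight of the coefficient is at most `−1`
    have hw : (if a ∈ A then (-1 : ℝ) else 0) + (if b ∈ B then (-1 : ℝ) else 0) +
        (if c ∈ C then (-1 : ℝ) else 0) ≤ -1 := by
      rcases key with h1 | h1 | h1 <;> simp only [h1, if_true] <;> split_ifs <;> norm_num
    -- (3) the average is `> −1`
    have hm0 : 0 < min (Fintype.card X) (min (Fintype.card Y) (Fintype.card Z)) :=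
      lt_of_le_of_lt (Nat.zero_le _) hlt
    set m : ℕ := min (Fintype.card X) (min (Fintype.card Y) (Fintype.card Z)) with hm
    have hsum : kx + ky + kz < m := lt_of_le_of_lt hk hlt
    have hmX : m ≤ Fintype.card X := min_le_left _ _
    have hmY : m ≤ Fintype.card Y := (min_le_right _ _).trans (min_le_left _ _)
    have hmZ : m ≤ Fintype.card Z := (min_le_right _ _).trans (min_le_right _ _)
    have hmR : (0 : ℝ) < m := by exact_mod_cast hm0
    have hXR : (m : ℝ) ≤ Fintype.card X := by exact_mod_cast hmX
    have hYR : (m : ℝ) ≤ Fintype.card Y := by exact_mod_cast hmY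
    have hZR : (m : ℝ) ≤ Fintype.card Z := by exact_mod_cast hmZ
    have hA' : (A.card : ℝ) / Fintype.card X ≤ A.card / m :=
      div_le_div_of_nonneg_left (Nat.cast_nonneg _) hmR hXR
    have hB' : (B.card : ℝ) / Fintype.card Y ≤ B.card / m :=
      div_le_div_of_nonneg_left (Nat.cast_nonneg _) hmR hYR
    have hC' : (C.card : ℝ) / Fintype.card Z ≤ C.card / m :=
      div_le_div_of_nonneg_left (Nat.cast_nonneg _) hmR hZR
    have htot : ((A.card : ℝ) + B.card + C.card) / m < 1 := by
      rw [div_lt_one hmR]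
      have : (A.card + B.card + C.card : ℕ) < m := by omega
      exact_mod_cast this
    have havg : -1 < (∑ a, (if a ∈ A then (-1 : ℝ) else 0)) / Fintype.card X +
        (∑ b, (if b ∈ B then (-1 : ℝ) else 0)) / Fintype.card Y +
        (∑ c, (if c ∈ C then (-1 : ℝ) else 0)) / Fintype.card Z := by
      rw [sum_negIndicator, sum_negIndicator, sum_negIndicator, neg_div, neg_div, neg_div]
      have : ((A.card : ℝ) + B.card + C.card) / m = A.card / m + B.card / m + C.card / m := by
        ring
      linarith
    exact lt_of_le_of_lt hw havg
  · -- the expansion of `F` in the product basis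
    intro x y z
    have e1 : F x y z = ∑ a, f.repr (fun x' => F x' y z) a * f a x :=
      apply_eq_sum_repr_mul f (fun x' => F x' y z) x
    rw [e1]
    refine Finset.sum_congr rfl fun a _ => ?_
    have e2 : f.repr (fun x' => F x' y z) a =
        ∑ b, g.repr (fun y' => f.repr (fun x' => F x' y' z) a) b * g b y :=
      apply_eq_sum_repr_mul g (fun y' => f.repr (fun x' => F x' y' z) a) y
    rw [e2, Finset.sum_mul]
    refine Finset.sum_congr rfl fun b _ => ?_
    have e3 : g.repr (fun y' => f.repr (fun x' => F x' y' z) a) b =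
        ∑ c, h.repr (fun z' => g.repr (fun y' => f.repr (fun x' => F x' y' z') a) b) c * h c z :=
      apply_eq_sum_repr_mul h (fun z' => g.repr (fun y' => f.repr (fun x' => F x' y' z') a) b) z
    rw [e3, Finset.sum_mul, Finset.sum_mul]
    refine Finset.sum_congr rfl fun c _ => ?_
    ring

end Thm46Proof

/-! ## Proof of Prop. 4.13 (the printed argument: triangular bases with weights `u_a = a` and
`R = k − 1`, giving `ε = 1/6`; the slice count of `F^{⊗n}` by low-weight index tuples, Prop. 4.12) -/

section Prop413Proof

open Module Finset
open Literature.Combinatorics.Additive (HasSliceRankLE hasSliceRankLE_of_cover LowWeight)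
open Literature.Barriers.MatrixMultiplication (card_lowWeight_le_pow)

variable {K : Type u} [Field K]

/-- Expansion of `F` in the product of three bases with the iterated coordinates as coefficients:
`F(x,y,z) = Σ_{a,b,c} [[[F(·,y,z)]_a]_b]_c f_a(x) g_b(y) h_c(z)` (valid for any bases).
[cite: BlasiakChurchCohnGrochowNaslundSawinUmans2017, Def. 4.3] -/
private theorem eq_sum_iterRepr {X Y Z : Type*} [Fintype X] [Fintype Y] [Fintype Z]
    (f : Basis X K (X → K)) (g : Basis Y K (Y → K)) (h : Basis Z K (Z → K))
    (F : X → Y → Z → K) (x : X) (y : Y) (z : Z) :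
    F x y z = ∑ a, ∑ b, ∑ c,
      h.repr (fun z' => g.repr (fun y' => f.repr (fun x' => F x' y' z') a) b) c *
        (f a x * g b y * h c z) := by
  have e1 : F x y z = ∑ a, f.repr (fun x' => F x' y z) a * f a x :=
    apply_eq_sum_repr_mul f (fun x' => F x' y z) x
  rw [e1]
  refine Finset.sum_congr rfl fun a _ => ?_
  have e2 : f.repr (fun x' => F x' y z) a =
      ∑ b, g.repr (fun y' => f.repr (fun x' => F x' y' z) a) b * g b y :=
    apply_eq_sum_repr_mul g (fun y' => f.repr (fun x' => F x' y' z) a) y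
  rw [e2, Finset.sum_mul]
  refine Finset.sum_congr rfl fun b _ => ?_
  have e3 : g.repr (fun y' => f.repr (fun x' => F x' y' z) a) b =
      ∑ c, h.repr (fun z' => g.repr (fun y' => f.repr (fun x' => F x' y' z') a) b) c * h c z :=
    apply_eq_sum_repr_mul h (fun z' => g.repr (fun y' => f.repr (fun x' => F x' y' z') a) b) z
  rw [e3, Finset.sum_mul, Finset.sum_mul]
  refine Finset.sum_congr rfl fun c _ => ?_
  ring

/-- Cyclic reordering of a triple sum. [folklore] -/
private theorem sum_rotate₃ {M : Type*} [AddCommMonoid M] {I J L : Type*} [Fintype I] [Fintype J]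
    [Fintype L] (t : I → J → L → M) :
    ∑ i, ∑ j, ∑ l, t i j l = ∑ l, ∑ i, ∑ j, t i j l := by
  calc ∑ i, ∑ j, ∑ l, t i j l = ∑ i, ∑ l, ∑ j, t i j l :=
        Finset.sum_congr rfl fun i _ => Finset.sum_comm
    _ = ∑ l, ∑ i, ∑ j, t i j l := Finset.sum_comm

/-- The iterated coordinates of a trilinear expansion `F = Σ ρ_{ijl} φ_i ⊗ ψ_j ⊗ χ_l` are
`Σ ρ_{ijl} [φ_i]_a [ψ_j]_b [χ_l]_c` (linearity of coordinates, one tensor factor at a time: the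
computation behind "the terms `f_a ⊗ g_b ⊗ h_c` can be replaced with a linear combination of terms
`f_{a'} ⊗ g_b ⊗ h_c`" of Rem. 4.5 (3)).
[cite: BlasiakChurchCohnGrochowNaslundSawinUmans2017, Rem. 4.5 (3)] -/
private theorem iterRepr_eq_sum {X Y Z : Type*} [Fintype X] [Fintype Y] [Fintype Z]
    (f : Basis X K (X → K)) (g : Basis Y K (Y → K)) (h : Basis Z K (Z → K))
    {I J L : Type*} [Fintype I] [Fintype J] [Fintype L] (ρ : I → J → L → K)
    (φ : I → X → K) (ψ : J → Y → K) (χ : L → Z → K) (F : X → Y → Z → K)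
    (hF : ∀ x y z, F x y z = ∑ i, ∑ j, ∑ l, ρ i j l * (φ i x * ψ j y * χ l z)) (a : X) (b : Y)
    (c : Z) :
    h.repr (fun z => g.repr (fun y => f.repr (fun x => F x y z) a) b) c =
      ∑ i, ∑ j, ∑ l, ρ i j l * (f.repr (φ i) a * g.repr (ψ j) b * h.repr (χ l) c) := by
  -- the `x`-coordinates of `F(·, y, z)`
  have s1 : ∀ y z, f.repr (fun x => F x y z) a =
      ∑ i, (∑ j, ∑ l, ρ i j l * (ψ j y * χ l z)) * f.repr (φ i) a := by
    intro y z
    have e : (fun x => F x y z) = fun x => ∑ i, (∑ j, ∑ l, ρ i j l * (ψ j y * χ l z)) * φ i x := by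
      funext x
      rw [hF x y z]
      refine Finset.sum_congr rfl fun i _ => ?_
      rw [Finset.sum_mul]
      refine Finset.sum_congr rfl fun j _ => ?_
      rw [Finset.sum_mul]
      refine Finset.sum_congr rfl fun l _ => ?_
      ring
    rw [e]
    exact repr_fun_sum_mul f a _ φ
  -- the `y`-coordinates
  have s2 : ∀ z, g.repr (fun y => f.repr (fun x => F x y z) a) b =
      ∑ j, (∑ i, ∑ l, ρ i j l * χ l z * f.repr (φ i) a) * g.repr (ψ j) b := by
    intro z
    have e : (fun y => f.repr (fun x => F x y z) a) =
        fun y => ∑ j, (∑ i, ∑ l, ρ i j l * χ l z * f.repr (φ i) a) * ψ j y := by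
      funext y
      rw [s1 y z]
      simp only [Finset.sum_mul]
      rw [Finset.sum_comm]
      refine Finset.sum_congr rfl fun j _ => Finset.sum_congr rfl fun i _ =>
        Finset.sum_congr rfl fun l _ => ?_
      ring
    rw [e]
    exact repr_fun_sum_mul g b _ ψ
  -- the `z`-coordinates
  have e : (fun z => g.repr (fun y => f.repr (fun x => F x y z) a) b) =
      fun z => ∑ l, (∑ j, ∑ i, ρ i j l * f.repr (φ i) a * g.repr (ψ j) b) * χ l z := by
    funext z
    rw [s2 z]
    simp only [Finset.sum_mul]
    rw [sum_rotate₃ (fun j i l => ρ i j l * χ l z * f.repr (φ i) a * g.repr (ψ j) b)]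
    refine Finset.sum_congr rfl fun l _ => Finset.sum_congr rfl fun j _ =>
      Finset.sum_congr rfl fun i _ => ?_
    ring
  rw [e, repr_fun_sum_mul h c _ χ]
  simp only [Finset.sum_mul]
  rw [sum_rotate₃ (fun i j l => ρ i j l * (f.repr (φ i) a * g.repr (ψ j) b * h.repr (χ l) c))]
  refine Finset.sum_congr rfl fun l _ => ?_
  rw [Finset.sum_comm]
  refine Finset.sum_congr rfl fun i _ => Finset.sum_congr rfl fun j _ => ?_
  ring

/-- **Triangular basis** (Rem. 4.5 (3), as used in the proof of Prop. 4.13: "if one function `f_a` is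
a linear combination of previous functions `f_{a'}` … the terms can be replaced …; we may assume
that the set of functions appearing is linearly independent. Then extend this set to a basis"):
for any `k = |X|` functions `φ₀, …, φ_{k−1} : X → K` there are a basis `b` of `K^X` indexed by `X`
and a numbering `σ : X ≃ {0, …, k−1}` such that every `φ_i` lies in the span of the `b_a` with
`σ(a) ≤ i`, i.e. `[φ_i]_a ≠ 0 ⇒ σ(a) ≤ i`.
[cite: BlasiakChurchCohnGrochowNaslundSawinUmans2017, Rem. 4.5 (3)] -/
private theorem exists_triangular_basis {X : Type*} [Fintype X] {k : ℕ}
    (hX : Fintype.card X = k) (φ : Fin k → X → K) :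
    ∃ (b : Basis X K (X → K)) (σ : X ≃ Fin k),
      ∀ i a, b.repr (φ i) a ≠ 0 → ((σ a : Fin k) : ℕ) ≤ i := by
  classical
  -- by induction: `m ≤ k` independent vectors with `φ_i ∈ span {v_j : j ≤ i}` for all `i < m`
  have main : ∀ m, m ≤ k → ∃ v : Fin m → X → K, LinearIndependent K v ∧
      ∀ i : Fin k, (i : ℕ) < m →
        φ i ∈ Submodule.span K (v '' {j : Fin m | (j : ℕ) ≤ i}) := by
    intro m
    induction m with
    | zero =>
      intro _
      exact ⟨fun j => Fin.elim0 j, linearIndependent_empty_type, fun i hi => absurd hi (by omega)⟩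
    | succ m ih =>
      intro hm
      obtain ⟨v, hv, hspan⟩ := ih (by omega)
      set S : Submodule K (X → K) := Submodule.span K (Set.range v) with hS
      -- `S` is a proper subspace: `dim S = m < k = dim K^X`
      have hSlt : ∃ x : X → K, x ∉ S := by
        by_contra hcon
        push Not at hcon
        have htop : S = ⊤ := Submodule.eq_top_iff'.2 hcon
        have h1 : finrank K S = m := by rw [hS, finrank_span_eq_card hv, Fintype.card_fin]
        have h2 : finrank K S = k := by
          rw [htop, finrank_top, Module.finrank_fintype_fun_eq_card, hX]
        omega
      obtain ⟨x, hx⟩ := hSlt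
      set im : Fin k := ⟨m, by omega⟩ with him
      -- the new vector: `φ_m` itself if it is not in the span of the previous ones, else a new one
      set y : X → K := if φ im ∈ S then x else φ im with hy
      have hyS : y ∉ S := by
        by_cases hc : φ im ∈ S
        · simpa [hy, hc] using hx
        · simp [hy, hc]
      refine ⟨Fin.snoc v y, hv.finSnoc hyS, fun i hi => ?_⟩
      rcases Nat.lt_succ_iff_lt_or_eq.1 hi with hlt | heq
      · -- an old index: the old partial span is contained in the new one
        refine Submodule.span_mono ?_ (hspan i hlt)
        rintro _ ⟨j, hj, rfl⟩
        exact ⟨Fin.castSucc j, by simpa using hj, by simp⟩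
      · -- the new index `i = m`
        have hi' : i = im := Fin.ext heq
        subst hi'
        have hall : (Fin.snoc v y : Fin (m + 1) → X → K) '' {j : Fin (m + 1) | (j : ℕ) ≤ (im : ℕ)} =
            Set.range (Fin.snoc v y : Fin (m + 1) → X → K) := by
          ext w
          constructor
          · rintro ⟨j, -, rfl⟩
            exact ⟨j, rfl⟩
          · rintro ⟨j, rfl⟩
            exact ⟨j, by simp only [Set.mem_setOf_eq, him]; omega, rfl⟩
        rw [hall]
        by_cases hc : φ im ∈ S
        · refine Submodule.span_mono ?_ hc
          rintro _ ⟨j, rfl⟩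
          exact ⟨Fin.castSucc j, by simp⟩
        · have hlast : φ im = (Fin.snoc v y : Fin (m + 1) → X → K) (Fin.last m) := by
            rw [Fin.snoc_last, hy, if_neg hc]
          rw [hlast]
          exact Submodule.subset_span ⟨Fin.last m, rfl⟩
  obtain ⟨v, hv, hspan⟩ := main k le_rfl
  -- `k = dim K^X` independent vectors form a basis; re-index it by `X`
  have hcard : Fintype.card (Fin k) = finrank K (X → K) := by
    rw [Fintype.card_fin, Module.finrank_fintype_fun_eq_card, hX]
  set B : Basis (Fin k) K (X → K) := basisOfLinearIndependentOfCardEqFinrank' v hv hcard with hB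
  set σ : X ≃ Fin k := Fintype.equivFinOfCardEq hX with hσ
  refine ⟨B.reindex σ.symm, σ, fun i a hne => ?_⟩
  have hvb : ∀ j, v j = B.reindex σ.symm (σ.symm j) := by
    intro j
    rw [Basis.reindex_apply, Equiv.symm_symm, Equiv.apply_symm_apply, hB,
      coe_basisOfLinearIndependentOfCardEqFinrank']
  have himg : v '' {j : Fin k | (j : ℕ) ≤ i} =
      B.reindex σ.symm '' {a : X | ((σ a : Fin k) : ℕ) ≤ i} := by
    ext w
    constructor
    · rintro ⟨j, hj, rfl⟩
      exact ⟨σ.symm j, by simpa using hj, (hvb j).symm⟩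
    · rintro ⟨a', ha', rfl⟩
      exact ⟨σ a', ha', by rw [hvb, Equiv.symm_apply_apply]⟩
  have hmem := hspan i i.isLt
  rw [himg, Basis.mem_span_image] at hmem
  exact hmem (Finsupp.mem_support_iff.2 hne)

/-- `Σ_{i<k} i = k(k−1)/2` over `ℝ`. [folklore] -/
private theorem sum_range_cast_mul_two (k : ℕ) :
    (∑ i ∈ Finset.range k, (i : ℝ)) * 2 = (k : ℝ) * ((k : ℝ) - 1) := by
  induction k with
  | zero => simp
  | succ k ih => rw [Finset.sum_range_succ, add_mul, ih]; push_cast; ring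

/-- The weights `u_a = σ(a) ∈ {0, …, k−1}` of the proof of Prop. 4.13 have mean `(k−1)/2` and range
`k − 1` ("`u_max = R` and `u_avg = R/2`", `R = k − 1`).
[cite: BlasiakChurchCohnGrochowNaslundSawinUmans2017, Prop. 4.13 (proof)] -/
private theorem weightStats {X : Type*} [Fintype X] {k : ℕ} (hk : 1 ≤ k) (σ : X ≃ Fin k) :
    (∑ a, (((σ a : Fin k) : ℕ) : ℝ)) / Fintype.card X = ((k : ℝ) - 1) / 2 ∧
      weightRange (fun a => (((σ a : Fin k) : ℕ) : ℝ)) = (k : ℝ) - 1 := by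
  have hcardX : Fintype.card X = k := by simpa using Fintype.card_congr σ
  have hk0 : (0 : ℝ) < k := by exact_mod_cast hk
  constructor
  · have hsum : (∑ a, (((σ a : Fin k) : ℕ) : ℝ)) = ∑ j : Fin k, ((j : ℕ) : ℝ) :=
      Equiv.sum_comp σ (fun j : Fin k => ((j : ℕ) : ℝ))
    rw [hcardX, hsum, Fin.sum_univ_eq_sum_range (fun i => (i : ℝ)) k]
    have h2 := sum_range_cast_mul_two k
    field_simp
    linarith
  · haveI : Nonempty X := ⟨σ.symm ⟨0, hk⟩⟩
    have hsup : (⨆ a, (((σ a : Fin k) : ℕ) : ℝ)) = (k : ℝ) - 1 := by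
      apply le_antisymm
      · refine ciSup_le fun a => ?_
        have h1 : (((σ a : Fin k) : ℕ) : ℝ) + 1 ≤ k := by exact_mod_cast (σ a).isLt
        linarith
      · have hk1 : k - 1 < k := by omega
        refine le_ciSup_of_le (Finite.bddAbove_range _) (σ.symm ⟨k - 1, hk1⟩) ?_
        rw [Equiv.apply_symm_apply, Nat.cast_sub hk, Nat.cast_one]
    have hinf : (⨅ a, (((σ a : Fin k) : ℕ) : ℝ)) = 0 := by
      apply le_antisymm
      · exact ciInf_le_of_le (Finite.bddBelow_range _) (σ.symm ⟨0, hk⟩) (by simp)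
      · exact le_ciInf fun a => Nat.cast_nonneg _
    rw [weightRange, hsup, hinf, sub_zero]

/-- **BCCGNSU 2017, Proposition 4.13, proved** (the printed proof). (i) Choose bases of `K^X`,
`K^Y`, `K^Z` triangular for the three families of the triangle-rank decomposition (Rem. 4.5 (3),
`exists_triangular_basis`) with weights `u_a = σ(a) ∈ {0,…,k−1}`: every product-basis coefficient of
`F` has weight `≤ a + b + c ≤ k − 1 = R`, while `u_avg = (k−1)/2` and `u_max − u_min = k − 1` in
each factor, so `R = Σ avg − ε Σ ranges` with `ε = 1/6`. (ii) Expanding `F^{⊗n}` along the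
decomposition, every index word `((a_m,b_m,c_m))_m` has `Σ_m (a_m+b_m+c_m) ≤ (k−1)n`, so one of
`3Σa_m, 3Σb_m, 3Σc_m` is `≤ (k−1)n`; grouping by it (`hasSliceRankLE_of_cover`, the step of the proof
of Thm. 4.10) gives `slicerank(F^{⊗n}) ≤ 3 · #{a ∈ {0,…,k−1}ⁿ : 3Σaᵢ ≤ (k−1)n} ≤ 3 (k J(k))ⁿ`
(Prop. 4.12, the tree's `card_lowWeight_le_pow`).
[cite: BlasiakChurchCohnGrochowNaslundSawinUmans2017, Prop. 4.13] -/
theorem BCCGNSU2017_prop413_holds : BCCGNSU2017_prop413 := by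
  intro K _ X Y Z _ _ _ k hk hX hY hZ F hF
  classical
  obtain ⟨φ, ψ, χ, ρ, hFsum⟩ := hF
  have hk1 : 1 ≤ k := by omega
  refine ⟨?_, fun n => ?_⟩
  · /- (i) the `1/6`-unstable decomposition -/
    -- the expansion with the cut-off folded into the coefficients
    set ρ' : Fin k → Fin k → Fin k → K := fun i j l => if (i : ℕ) + j + l < k then ρ i j l else 0
      with hρ'
    have hF' : ∀ x y z, F x y z = ∑ i, ∑ j, ∑ l, ρ' i j l * (φ i x * ψ j y * χ l z) := by
      intro x y z
      rw [hFsum x y z]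
      refine Finset.sum_congr rfl fun i _ => Finset.sum_congr rfl fun j _ =>
        Finset.sum_congr rfl fun l _ => ?_
      simp only [hρ']
      split_ifs <;> simp
    obtain ⟨f, σ, hf⟩ := exists_triangular_basis (K := K) hX φ
    obtain ⟨g, τ, hg⟩ := exists_triangular_basis (K := K) hY ψ
    obtain ⟨h, υ, hh⟩ := exists_triangular_basis (K := K) hZ χ
    obtain ⟨hXavg, hXr⟩ := weightStats hk1 σ
    obtain ⟨hYavg, hYr⟩ := weightStats hk1 τ
    obtain ⟨hZavg, hZr⟩ := weightStats hk1 υ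
    refine ⟨f, g, h, fun a => (((σ a : Fin k) : ℕ) : ℝ), fun b => (((τ b : Fin k) : ℕ) : ℝ),
      fun c => (((υ c : Fin k) : ℕ) : ℝ),
      fun a b c => h.repr (fun z => g.repr (fun y => f.repr (fun x => F x y z) a) b) c,
      ?_, ?_, fun x y z => eq_sum_iterRepr f g h F x y z⟩
    · -- the weights are not all constant (`k ≥ 2`: the values `0` and `1` occur)
      rintro ⟨hu, -, -⟩
      have h01 := hu (σ.symm ⟨0, by omega⟩) (σ.symm ⟨1, by omega⟩)
      simp at h01
    · -- support of the coefficients: weight `≤ k − 1 = R`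
      intro a b c hne
      dsimp only at hne
      rw [iterRepr_eq_sum f g h ρ' φ ψ χ F hF' a b c] at hne
      obtain ⟨i, -, hi⟩ := Finset.exists_ne_zero_of_sum_ne_zero hne
      obtain ⟨j, -, hj⟩ := Finset.exists_ne_zero_of_sum_ne_zero hi
      obtain ⟨l, -, hl⟩ := Finset.exists_ne_zero_of_sum_ne_zero hj
      have hρne : ρ' i j l ≠ 0 := left_ne_zero_of_mul hl
      have hijl : (i : ℕ) + j + l < k := by
        by_contra hcon
        exact hρne (by simp only [hρ', if_neg hcon])
      have hprod := right_ne_zero_of_mul hl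
      have ha : ((σ a : Fin k) : ℕ) ≤ i :=
        hf i a (left_ne_zero_of_mul (left_ne_zero_of_mul hprod))
      have hb : ((τ b : Fin k) : ℕ) ≤ j :=
        hg j b (right_ne_zero_of_mul (left_ne_zero_of_mul hprod))
      have hc : ((υ c : Fin k) : ℕ) ≤ l := hh l c (right_ne_zero_of_mul hprod)
      have hsum : (((σ a : Fin k) : ℕ) : ℝ) + (((τ b : Fin k) : ℕ) : ℝ) +
          (((υ c : Fin k) : ℕ) : ℝ) + 1 ≤ k := by
        exact_mod_cast (show ((σ a : Fin k) : ℕ) + ((τ b : Fin k) : ℕ) + ((υ c : Fin k) : ℕ) + 1 ≤ k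
          by omega)
      dsimp only
      rw [hXavg, hYavg, hZavg, hXr, hYr, hZr]
      linarith
  · /- (ii) the slice rank of `F^{⊗n}` -/
    haveI : NeZero k := ⟨by omega⟩
    -- the index set of the triangle decomposition
    set T := {s : Fin k × Fin k × Fin k // (s.1 : ℕ) + s.2.1 + s.2.2 < k} with hT
    have hF' : ∀ x y z, F x y z =
        ∑ s : T, ρ s.1.1 s.1.2.1 s.1.2.2 * (φ s.1.1 x * ψ s.1.2.1 y * χ s.1.2.2 z) := by
      intro x y z
      rw [hFsum x y z]
      have e1 : (∑ i : Fin k, ∑ j : Fin k, ∑ l : Fin k,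
          if (i : ℕ) + (j : ℕ) + (l : ℕ) < k then ρ i j l * (φ i x * ψ j y * χ l z) else 0) =
          ∑ s : Fin k × Fin k × Fin k, if (s.1 : ℕ) + s.2.1 + s.2.2 < k then
            ρ s.1 s.2.1 s.2.2 * (φ s.1 x * ψ s.2.1 y * χ s.2.2 z) else 0 := by
        simp only [Fintype.sum_prod_type]
      rw [e1, ← Finset.sum_filter]
      exact Finset.sum_subtype _ (fun s => by simp) _
    -- the product expansion of `F^{⊗n}` indexed by words `ω : Fin n → T`
    set coef : (Fin n → T) → K := fun ω => ∏ m, ρ (ω m).1.1 (ω m).1.2.1 (ω m).1.2.2 with hcoef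
    have hKP : ∀ x y z, kroneckerPow F n x y z = ∑ ω : Fin n → T, coef ω *
        ((∏ m, φ (ω m).1.1 (x m)) * (∏ m, ψ (ω m).1.2.1 (y m)) * ∏ m, χ (ω m).1.2.2 (z m)) := by
      intro x y z
      rw [kroneckerPow_apply]
      simp_rw [hF']
      rw [Fintype.prod_sum]
      refine Finset.sum_congr rfl fun ω _ => ?_
      rw [hcoef, Finset.prod_mul_distrib, Finset.prod_mul_distrib, Finset.prod_mul_distrib]
    -- weights of a word and the three classes
    set A : (Fin n → T) → Fin n → ℕ := fun ω m => ((ω m).1.1 : ℕ) with hA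
    set B : (Fin n → T) → Fin n → ℕ := fun ω m => ((ω m).1.2.1 : ℕ) with hB
    set C : (Fin n → T) → Fin n → ℕ := fun ω m => ((ω m).1.2.2 : ℕ) with hC
    have hABC : ∀ ω, (∑ m, A ω m) + (∑ m, B ω m) + (∑ m, C ω m) ≤ (k - 1) * n := by
      intro ω
      rw [← Finset.sum_add_distrib, ← Finset.sum_add_distrib]
      have hle : ∀ m, A ω m + B ω m + C ω m ≤ k - 1 := by
        intro m
        have := (ω m).2
        simp only [hA, hB, hC]
        omega
      calc ∑ m, (A ω m + B ω m + C ω m) ≤ ∑ _m : Fin n, (k - 1) :=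
            Finset.sum_le_sum fun m _ => hle m
        _ = (k - 1) * n := by rw [Finset.sum_const, Finset.card_univ, Fintype.card_fin, smul_eq_mul, mul_comm]
    set c : (Fin n → T) → Fin 3 := fun ω =>
      if 3 * ∑ m, A ω m ≤ (k - 1) * n then 0 else if 3 * ∑ m, B ω m ≤ (k - 1) * n then 1 else 2
      with hc
    set v0 : LowWeight k (Fin n) := ⟨fun _ => 0, by simp⟩ with hv0
    set πx : (Fin n → T) → LowWeight k (Fin n) := fun ω =>
      if hω : 3 * ∑ m, A ω m ≤ (k - 1) * n then ⟨fun m => (ω m).1.1, by simpa [hA] using hω⟩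
      else v0 with hπx
    set πy : (Fin n → T) → LowWeight k (Fin n) := fun ω =>
      if hω : 3 * ∑ m, B ω m ≤ (k - 1) * n then ⟨fun m => (ω m).1.2.1, by simpa [hB] using hω⟩
      else v0 with hπy
    set πz : (Fin n → T) → LowWeight k (Fin n) := fun ω =>
      if hω : 3 * ∑ m, C ω m ≤ (k - 1) * n then ⟨fun m => (ω m).1.2.2, by simpa [hC] using hω⟩
      else v0 with hπz
    set Φ : LowWeight k (Fin n) → (Fin n → X) → K := fun v x => ∏ m, φ (v.1 m) (x m) with hΦ
    set Ψ : LowWeight k (Fin n) → (Fin n → Y) → K := fun v y => ∏ m, ψ (v.1 m) (y m) with hΨ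
    set Θ : LowWeight k (Fin n) → (Fin n → Z) → K := fun v z => ∏ m, χ (v.1 m) (z m) with hΘ
    -- the rank-one terms, with the scalar `coef ω` kept off the factor that must stay pure
    set Fx : (Fin n → T) → (Fin n → X) → K := fun ω x =>
      (if 3 * ∑ m, A ω m ≤ (k - 1) * n then 1 else coef ω) * ∏ m, φ (ω m).1.1 (x m) with hFx
    set Fy : (Fin n → T) → (Fin n → Y) → K := fun ω y =>
      (if 3 * ∑ m, A ω m ≤ (k - 1) * n then coef ω else 1) * ∏ m, ψ (ω m).1.2.1 (y m) with hFy
    set Fz : (Fin n → T) → (Fin n → Z) → K := fun ω z => ∏ m, χ (ω m).1.2.2 (z m) with hFz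
    have hD : ∀ x y z, kroneckerPow F n x y z = ∑ ω, Fx ω x * Fy ω y * Fz ω z := by
      intro x y z
      rw [hKP x y z]
      refine Finset.sum_congr rfl fun ω _ => ?_
      simp only [hFx, hFy, hFz]
      split_ifs <;> ring
    have hcover : HasSliceRankLE (kroneckerPow F n)
        (Fintype.card (LowWeight k (Fin n)) + Fintype.card (LowWeight k (Fin n)) +
          Fintype.card (LowWeight k (Fin n))) := by
      refine hasSliceRankLE_of_cover _ Fx Fy Fz hD c πx Φ ?_ πy Ψ ?_ πz Θ ?_
      · intro ω h0
        have hAω : 3 * ∑ m, A ω m ≤ (k - 1) * n := by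
          by_contra hAω
          simp only [hc, if_neg hAω] at h0
          split_ifs at h0 with hBω <;> exact absurd h0 (by decide)
        funext x
        simp only [hFx, if_pos hAω, one_mul, hπx, dif_pos hAω, hΦ]
      · intro ω h1'
        have hAω : ¬ 3 * ∑ m, A ω m ≤ (k - 1) * n := by
          intro hAω
          simp only [hc, if_pos hAω] at h1'
          exact absurd h1' (by decide)
        have hBω : 3 * ∑ m, B ω m ≤ (k - 1) * n := by
          by_contra hBω
          simp only [hc, if_neg hAω, if_neg hBω] at h1'
          exact absurd h1' (by decide)
        funext y
        simp only [hFy, if_neg hAω, one_mul, hπy, dif_pos hBω, hΨ]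
      · intro ω h2
        have hAω : ¬ 3 * ∑ m, A ω m ≤ (k - 1) * n := by
          intro hAω
          simp only [hc, if_pos hAω] at h2
          exact absurd h2 (by decide)
        have hBω : ¬ 3 * ∑ m, B ω m ≤ (k - 1) * n := by
          intro hBω
          simp only [hc, if_neg hAω, if_pos hBω] at h2
          exact absurd h2 (by decide)
        have hCω : 3 * ∑ m, C ω m ≤ (k - 1) * n := by
          have hω := hABC ω
          omega
        funext z
        simp only [hFz, hπz, dif_pos hCω, hΘ]
    -- count the low-weight words (Prop. 4.12)
    have hsr : (sliceRank (kroneckerPow F n) : ℝ) ≤ 3 * Fintype.card (LowWeight k (Fin n)) := by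
      have h1 := hcover.sliceRank_le
      have h2 : (sliceRank (kroneckerPow F n) : ℝ) ≤
          ((Fintype.card (LowWeight k (Fin n)) + Fintype.card (LowWeight k (Fin n)) +
            Fintype.card (LowWeight k (Fin n)) : ℕ) : ℝ) := by exact_mod_cast h1
      refine h2.trans (le_of_eq ?_)
      push_cast
      ring
    have hcount : (Fintype.card (LowWeight k (Fin n)) : ℝ) ≤ ((k : ℝ) * bccgnsuJ k) ^ n := by
      have h := card_lowWeight_le_pow hk1 (Fin n)
      have e : ((k : ℝ) * bccgnsuJ k) ^ Fintype.card (Fin n) = ((k : ℝ) * bccgnsuJ k) ^ n := by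
        rw [Fintype.card_fin]
      exact h.trans (le_of_eq e)
    calc (sliceRank (kroneckerPow F n) : ℝ) ≤ 3 * Fintype.card (LowWeight k (Fin n)) := hsr
      _ ≤ 3 * ((k : ℝ) * bccgnsuJ k) ^ n := by linarith

end Prop413Proof

/-! ## Proof of Thm. 4.10 (the printed argument: the product-basis expansion of `F^{⊗n}` is grouped by
a direction whose summed weight is at most `n` times its bound `u_bound = u_avg − ε(u_max − u_min)`;
Hoeffding's inequality counts the tuples with low summed weight) -/

section Thm410Proof

open Finset
open Literature.Barriers.MatrixMultiplication (sliceRank_le_of_block sliceRank_le_of_tensorRestrictsTo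
  sliceRank_le_card)
open Literature.Computability.Complexity (card_upperDeviation_sum_le_exp)

variable {K : Type u} [Field K]

/-- A constant weight vector sums to `n · u_avg` along every `n`-tuple.
[cite: BlasiakChurchCohnGrochowNaslundSawinUmans2017, Thm. 4.10 (proof)] -/
private theorem sum_weight_eq_of_const {X : Type*} [Fintype X] {u : X → ℝ}
    (hu : ∀ a a', u a = u a') {n : ℕ} (a : Fin n → X) :
    ∑ i, u (a i) = n * ((∑ b, u b) / Fintype.card X) := by
  have hmean : ∀ x : X, (∑ b, u b) / Fintype.card X = u x := by
    intro x
    have hc : (0 : ℝ) < Fintype.card X := by exact_mod_cast Fintype.card_pos_iff.2 ⟨x⟩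
    rw [div_eq_iff hc.ne', Finset.sum_congr rfl fun b _ => hu b x, Finset.sum_const,
      Finset.card_univ, nsmul_eq_mul, mul_comm]
  calc ∑ i, u (a i) = ∑ _i : Fin n, (∑ b, u b) / Fintype.card X :=
        Finset.sum_congr rfl fun i _ => (hmean (a i)).symm
    _ = n * ((∑ b, u b) / Fintype.card X) := by
        rw [Finset.sum_const, Finset.card_univ, Fintype.card_fin, nsmul_eq_mul]

/-- A weight vector that is not constant has positive range `u_max − u_min`.
[cite: BlasiakChurchCohnGrochowNaslundSawinUmans2017, Def. 4.4] -/
private theorem weightRange_pos_of_not_const {X : Type*} [Fintype X] {u : X → ℝ}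
    (hu : ¬ ∀ a a', u a = u a') : 0 < weightRange u := by
  push Not at hu
  obtain ⟨a, a', hne⟩ := hu
  have h1 : ∀ x, u x ≤ ⨆ b, u b := fun x => le_ciSup (Finite.bddAbove_range u) x
  have h2 : ∀ x, (⨅ b, u b) ≤ u x := fun x => ciInf_le (Finite.bddBelow_range u) x
  unfold weightRange
  rcases lt_or_gt_of_ne hne with h | h
  · linarith [h1 a', h2 a]
  · linarith [h1 a, h2 a']

/-- **Hoeffding's inequality for one summed weight** (the "classical large deviation estimate" of
the printed proof): for a non-constant weight vector `u` on `X`, `ε ≥ 0` and `n ≥ 1`, the number of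
tuples `a ∈ Xⁿ` with `u_{a_1} + ⋯ + u_{a_n} ≤ n (u_avg − ε (u_max − u_min))` is at most
`|X|ⁿ e^{−2nε²}` — the tree's counting Hoeffding bound `card_upperDeviation_sum_le_exp` applied to the
`[0,1]`-valued variable `(u_max − u)/(u_max − u_min)`.
[cite: BlasiakChurchCohnGrochowNaslundSawinUmans2017, Thm. 4.10 (proof)] -/
private theorem card_filter_sum_weight_le_bound {X : Type*} [Fintype X] (u : X → ℝ)
    (hu : ¬ ∀ a a', u a = u a') {ε : ℝ} (hε : 0 ≤ ε) {n : ℕ} (hn : 0 < n) :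
    ((univ.filter fun a : Fin n → X =>
        ∑ i, u (a i) ≤ n * ((∑ b, u b) / Fintype.card X - ε * weightRange u)).card : ℝ) ≤
      Real.exp (-2 * n * ε ^ 2) * (Fintype.card X : ℝ) ^ n := by
  haveI : Nonempty X := by
    by_contra h
    rw [not_nonempty_iff] at h
    exact hu fun a => isEmptyElim a
  set M : ℝ := ⨆ b, u b with hM
  set ρ : ℝ := weightRange u with hρ
  have hρ0 : 0 < ρ := weightRange_pos_of_not_const hu
  have hle : ∀ x, u x ≤ M := fun x => le_ciSup (Finite.bddAbove_range u) x
  have hge : ∀ x, M - ρ ≤ u x := fun x => by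
    have hx := ciInf_le (Finite.bddBelow_range u) x
    simp only [hρ, weightRange, hM]
    linarith
  -- the rescaled variable `G = (u_max − u)/(u_max − u_min) ∈ [0, 1]`
  set G : X → ℝ := fun x => (M - u x) / ρ with hG
  have hG01 : ∀ x, G x ∈ Set.Icc (0 : ℝ) 1 := fun x => by
    simp only [hG, Set.mem_Icc]
    refine ⟨div_nonneg (by linarith [hle x]) hρ0.le, ?_⟩
    rw [div_le_one hρ0]
    linarith [hge x]
  have h := card_upperDeviation_sum_le_exp G hG01 hn hε
  have hcard : (Fintype.card (Fin n → X) : ℝ) = (Fintype.card X : ℝ) ^ n := by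
    rw [Fintype.card_fun, Fintype.card_fin, Nat.cast_pow]
  have hX : (0 : ℝ) < Fintype.card X := by exact_mod_cast Fintype.card_pos
  -- the low-weight tuples form a sub-event of Hoeffding's upper-tail event for `G`
  have hsub : (univ.filter fun a : Fin n → X =>
        ∑ i, u (a i) ≤ n * ((∑ b, u b) / Fintype.card X - ε * weightRange u)) ⊆
      (univ.filter fun ω : Fin n → X => (n : ℝ) * ε ≤
        (∑ i, G (ω i)) - n * ((∑ a, G a) / Fintype.card X)) := by
    intro a ha
    rw [mem_filter] at ha ⊢
    refine ⟨mem_univ _, ?_⟩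
    have hid : ρ * ((∑ i, G (a i)) - n * ((∑ x, G x) / Fintype.card X)) =
        n * ((∑ b, u b) / Fintype.card X) - ∑ i, u (a i) := by
      have e1 : ∑ i, G (a i) = ((n : ℝ) * M - ∑ i, u (a i)) / ρ := by
        simp only [hG]
        rw [← Finset.sum_div, Finset.sum_sub_distrib, Finset.sum_const, card_univ,
          Fintype.card_fin, nsmul_eq_mul]
      have e2 : ∑ x, G x = ((Fintype.card X : ℝ) * M - ∑ x, u x) / ρ := by
        simp only [hG]
        rw [← Finset.sum_div, Finset.sum_sub_distrib, Finset.sum_const, card_univ, nsmul_eq_mul]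
      rw [e1, e2]
      field_simp
      ring
    have hlow : (n : ℝ) * ε * ρ ≤ ρ * ((∑ i, G (a i)) - n * ((∑ x, G x) / Fintype.card X)) := by
      rw [hid]
      have := ha.2
      rw [← hρ] at this
      nlinarith
    have hlow' : ρ * ((n : ℝ) * ε) ≤ ρ * ((∑ i, G (a i)) - n * ((∑ x, G x) / Fintype.card X)) := by
      linarith
    exact le_of_mul_le_mul_left hlow' hρ0
  calc _ ≤ (((univ.filter fun ω : Fin n → X => (n : ℝ) * ε ≤
          (∑ i, G (ω i)) - n * ((∑ a, G a) / Fintype.card X)).card : ℕ) : ℝ) := by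
        exact_mod_cast card_le_card hsub
    _ ≤ Real.exp (-2 * n * ε ^ 2) * Fintype.card (Fin n → X) := h
    _ = Real.exp (-2 * n * ε ^ 2) * (Fintype.card X : ℝ) ^ n := by rw [hcard]

/-- The low-weight set of one direction in the proof of Thm. 4.10, taken to be EMPTY when that
direction's weights are constant (then it is never needed: see `bound_le_sum_weight_of_not_mem`),
has at most `|X|ⁿ e^{−2nε²}` elements. (The printed proof applies Hoeffding to all three directions;
for a constant weight vector Hoeffding gives nothing, but Def. 4.4 only excludes the case where all
three weight vectors are constant — this is the one place where the bookkeeping deviates from print.)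
[cite: BlasiakChurchCohnGrochowNaslundSawinUmans2017, Thm. 4.10 (proof)] -/
private theorem card_lowSet_le {X : Type*} [Fintype X] (u : X → ℝ) {ε : ℝ} (hε : 0 ≤ ε) {n : ℕ}
    (hn : 0 < n) [DecidablePred fun a : Fin n → X => ¬ (∀ a a', u a = u a') ∧
        ∑ i, u (a i) ≤ n * ((∑ b, u b) / Fintype.card X - ε * weightRange u)] :
    ((univ.filter fun a : Fin n → X => ¬ (∀ a a', u a = u a') ∧
        ∑ i, u (a i) ≤ n * ((∑ b, u b) / Fintype.card X - ε * weightRange u)).card : ℝ) ≤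
      Real.exp (-2 * n * ε ^ 2) * (Fintype.card X : ℝ) ^ n := by
  by_cases hu : ∀ a a', u a = u a'
  · have h0 : (univ.filter fun a : Fin n → X => ¬ (∀ a a', u a = u a') ∧
        ∑ i, u (a i) ≤ n * ((∑ b, u b) / Fintype.card X - ε * weightRange u)) = ∅ :=
      Finset.filter_eq_empty_iff.2 fun a _ hcon => hcon.1 hu
    rw [h0, Finset.card_empty, Nat.cast_zero]
    positivity
  · have h1 : (univ.filter fun a : Fin n → X => ¬ (∀ a a', u a = u a') ∧
        ∑ i, u (a i) ≤ n * ((∑ b, u b) / Fintype.card X - ε * weightRange u)) =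
        univ.filter fun a : Fin n → X =>
          ∑ i, u (a i) ≤ n * ((∑ b, u b) / Fintype.card X - ε * weightRange u) :=
      Finset.filter_congr fun a _ => ⟨fun ha => ha.2, fun ha => ⟨hu, ha⟩⟩
    rw [h1]
    exact card_filter_sum_weight_le_bound u hu hε hn

/-- Outside the low-weight set the summed weight of a direction is at least `n` times its bound, and
strictly larger unless that direction's weights are constant (a constant direction sums to exactly
`n u_avg ≥ n (u_avg − ε · 0)`). [cite: BlasiakChurchCohnGrochowNaslundSawinUmans2017, Thm. 4.10 (proof)] -/
private theorem bound_le_sum_weight_of_not_mem {X : Type*} [Fintype X] (u : X → ℝ) {ε : ℝ}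
    (hε : 0 ≤ ε) {n : ℕ} [DecidablePred fun a : Fin n → X => ¬ (∀ a a', u a = u a') ∧
        ∑ i, u (a i) ≤ n * ((∑ b, u b) / Fintype.card X - ε * weightRange u)]
    (a : Fin n → X)
    (ha : a ∉ (univ.filter fun a : Fin n → X => ¬ (∀ a a', u a = u a') ∧
        ∑ i, u (a i) ≤ n * ((∑ b, u b) / Fintype.card X - ε * weightRange u))) :
    n * ((∑ b, u b) / Fintype.card X - ε * weightRange u) ≤ ∑ i, u (a i) ∧
      (¬ (∀ a a', u a = u a') →
        n * ((∑ b, u b) / Fintype.card X - ε * weightRange u) < ∑ i, u (a i)) := by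
  simp only [mem_filter, mem_univ, true_and, not_and, not_le] at ha
  by_cases hu : ∀ a a', u a = u a'
  · refine ⟨?_, fun h => absurd hu h⟩
    rw [sum_weight_eq_of_const hu a, mul_sub]
    have h3 : 0 ≤ (n : ℝ) * (ε * weightRange u) :=
      mul_nonneg (Nat.cast_nonneg _) (mul_nonneg hε (weightRange_nonneg u))
    linarith
  · exact ⟨(ha hu).le, fun _ => ha hu⟩

/-- **BCCGNSU 2017, Theorem 4.10 — the bound for one admissible `ε`, proved** (the printed proof;
no "unstable" hypothesis is needed beyond the `ε`-unstable decomposition itself). Let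
`f_a, g_b, h_c`, `u, v, w`, `r` be an `ε`-unstable decomposition of `F` (Def. 4.4). (i) `F` is the
restriction of the coefficient tensor `r` along the three basis matrices, so `F^{⊗n}` is a
restriction of `r^{⊗n}` and `slicerank(F^{⊗n}) ≤ slicerank(r^{⊗n})`
(`sliceRank_le_of_tensorRestrictsTo`; this is the step
"`F^{⊗n} = Σ r_{𝐚,𝐛,𝐜} f_𝐚(𝐱) g_𝐛(𝐲) h_𝐜(𝐳)`"). (ii) If `r_{𝐚,𝐛,𝐜} = ∏ r_{aᵢbᵢcᵢ} ≠ 0` then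
`u_𝐚 + v_𝐛 + w_𝐜 ≤ nR = n(u_bound + v_bound + w_bound)`, so one of `u_𝐚 ≤ n u_bound`,
`v_𝐛 ≤ n v_bound`, `w_𝐜 ≤ n w_bound` holds — and it can be taken in a direction whose weights are
not constant (constant directions contribute exactly `n u_avg`); hence `r^{⊗n}` vanishes off the
three low-weight blocks and `slicerank(r^{⊗n}) ≤ #S₁ + #S₂ + #S₃` (the step "collect terms",
`sliceRank_le_of_block`). (iii) Hoeffding: `#S₁ ≤ |X|ⁿe^{−2nε²}` etc. (`card_lowSet_le`).
[cite: BlasiakChurchCohnGrochowNaslundSawinUmans2017, Thm. 4.10] -/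
theorem sliceRank_kroneckerPow_le_of_isEpsUnstable {X : Type v₁} {Y : Type v₂} {Z : Type v₃}
    [Fintype X] [Fintype Y] [Fintype Z] (F : X → Y → Z → K) {ε : ℝ} (hε : 0 ≤ ε)
    (hεF : IsEpsUnstable F ε) (n : ℕ) (hn : 1 ≤ n) :
    (sliceRank (kroneckerPow F n) : ℝ) ≤
      ((Fintype.card X : ℝ) ^ n + (Fintype.card Y : ℝ) ^ n + (Fintype.card Z : ℝ) ^ n) *
        Real.exp (-2 * n * ε ^ 2) := by
  classical
  obtain ⟨f, g, h, u, v, w, r, hnc, hr, hF⟩ := hεF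
  have hn0 : 0 < n := hn
  -- (i) `F` is a restriction of `r`; slice rank is monotone along `r^{⊗n} ≥ F^{⊗n}`
  have hres : TensorRestrictsTo r F := by
    refine ⟨fun x a => f a x, fun y b => g b y, fun z c => h c z, fun x y z => ?_⟩
    rw [hF x y z]
    refine Finset.sum_congr rfl fun a _ => Finset.sum_congr rfl fun b _ =>
      Finset.sum_congr rfl fun c _ => ?_
    ring
  have hmono : sliceRank (kroneckerPow F n) ≤ sliceRank (kroneckerPow r n) :=
    sliceRank_le_of_tensorRestrictsTo (hres.kroneckerPow n)
  -- the three bounds `n u_bound`, `n v_bound`, `n w_bound`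
  set Bu : ℝ := n * ((∑ b, u b) / Fintype.card X - ε * weightRange u) with hBu
  set Bv : ℝ := n * ((∑ b, v b) / Fintype.card Y - ε * weightRange v) with hBv
  set Bw : ℝ := n * ((∑ b, w b) / Fintype.card Z - ε * weightRange w) with hBw
  -- (ii) the three low-weight sets (empty for a constant direction) and the block criterion
  set S₁ : Finset (Fin n → X) :=
    univ.filter fun a : Fin n → X => ¬ (∀ a a', u a = u a') ∧ ∑ i, u (a i) ≤ Bu with hS₁
  set S₂ : Finset (Fin n → Y) :=
    univ.filter fun b : Fin n → Y => ¬ (∀ b b', v b = v b') ∧ ∑ i, v (b i) ≤ Bv with hS₂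
  set S₃ : Finset (Fin n → Z) :=
    univ.filter fun c : Fin n → Z => ¬ (∀ c c', w c = w c') ∧ ∑ i, w (c i) ≤ Bw with hS₃
  have hblock : ∀ a b c, a ∉ S₁ → b ∉ S₂ → c ∉ S₃ → kroneckerPow r n a b c = 0 := by
    intro a b c ha hb hc
    by_contra hne
    rw [kroneckerPow_apply] at hne
    have hall : ∀ i ∈ (univ : Finset (Fin n)), r (a i) (b i) (c i) ≠ 0 :=
      Finset.prod_ne_zero_iff.1 hne
    -- the support condition, summed over the `n` coordinates
    have hsum : (∑ i, u (a i)) + (∑ i, v (b i)) + (∑ i, w (c i)) ≤ Bu + Bv + Bw := by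
      have h1 : ∀ i ∈ (univ : Finset (Fin n)), u (a i) + v (b i) + w (c i) ≤
          (∑ b, u b) / Fintype.card X + (∑ b, v b) / Fintype.card Y +
            (∑ c, w c) / Fintype.card Z - ε * (weightRange u + weightRange v + weightRange w) :=
        fun i hi => hr _ _ _ (hall i hi)
      have h2 := Finset.sum_le_sum h1
      rw [Finset.sum_const, card_univ, Fintype.card_fin, nsmul_eq_mul, Finset.sum_add_distrib,
        Finset.sum_add_distrib] at h2
      have h3 : (n : ℝ) * ((∑ b, u b) / Fintype.card X + (∑ b, v b) / Fintype.card Y +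
          (∑ c, w c) / Fintype.card Z - ε * (weightRange u + weightRange v + weightRange w)) =
          Bu + Bv + Bw := by
        simp only [hBu, hBv, hBw]; ring
      linarith
    -- outside the blocks each direction is at least its bound, one of them strictly
    obtain ⟨hu1, hu2⟩ := bound_le_sum_weight_of_not_mem u hε a ha
    obtain ⟨hv1, hv2⟩ := bound_le_sum_weight_of_not_mem v hε b hb
    obtain ⟨hw1, hw2⟩ := bound_le_sum_weight_of_not_mem w hε c hc
    have hlt : Bu + Bv + Bw < (∑ i, u (a i)) + (∑ i, v (b i)) + (∑ i, w (c i)) := by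
      by_cases cu : ∀ a a', u a = u a'
      · by_cases cv : ∀ b b', v b = v b'
        · have cw : ¬ ∀ c c', w c = w c' := fun cw => hnc ⟨cu, cv, cw⟩
          linarith [hw2 cw]
        · linarith [hv2 cv]
      · linarith [hu2 cu]
    linarith
  have hSR : sliceRank (kroneckerPow r n) ≤ S₁.card + S₂.card + S₃.card :=
    sliceRank_le_of_block _ S₁ S₂ S₃ hblock
  -- (iii) Hoeffding in each direction
  have h1 : (S₁.card : ℝ) ≤ Real.exp (-2 * n * ε ^ 2) * (Fintype.card X : ℝ) ^ n :=
    card_lowSet_le u hε hn0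
  have h2 : (S₂.card : ℝ) ≤ Real.exp (-2 * n * ε ^ 2) * (Fintype.card Y : ℝ) ^ n :=
    card_lowSet_le v hε hn0
  have h3 : (S₃.card : ℝ) ≤ Real.exp (-2 * n * ε ^ 2) * (Fintype.card Z : ℝ) ^ n :=
    card_lowSet_le w hε hn0
  calc (sliceRank (kroneckerPow F n) : ℝ) ≤ ((S₁.card + S₂.card + S₃.card : ℕ) : ℝ) := by
        exact_mod_cast hmono.trans hSR
    _ = (S₁.card : ℝ) + S₂.card + S₃.card := by push_cast; ring
    _ ≤ Real.exp (-2 * n * ε ^ 2) * (Fintype.card X : ℝ) ^ n +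
          Real.exp (-2 * n * ε ^ 2) * (Fintype.card Y : ℝ) ^ n +
          Real.exp (-2 * n * ε ^ 2) * (Fintype.card Z : ℝ) ^ n := by linarith
    _ = ((Fintype.card X : ℝ) ^ n + (Fintype.card Y : ℝ) ^ n + (Fintype.card Z : ℝ) ^ n) *
          Real.exp (-2 * n * ε ^ 2) := by ring

/-- **BCCGNSU 2017, Theorem 4.10, proved**: the named fact `BCCGNSU2017_thm410` holds
(`sliceRank_kroneckerPow_le_of_isEpsUnstable`; the hypothesis "`F` unstable" of the fact is not
even needed for the bound at an admissible `ε`).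
[cite: BlasiakChurchCohnGrochowNaslundSawinUmans2017, Thm. 4.10] -/
theorem BCCGNSU2017_thm410_holds : BCCGNSU2017_thm410 :=
  fun F _ _ hε hεF n hn => sliceRank_kroneckerPow_le_of_isEpsUnstable F hε hεF n hn

/-- Below the instability every `ε ≥ 0` is admissible ("It suffices to prove for all
`ε < instability(F)` … Given such an `ε`, we can choose functions `f_a, g_b, h_c`, weights
`u_a, v_b, w_c`, and coefficients `r_{a,b,c}` as in Definition 4.4": the supremum is approached by
admissible values and the admissible set is downward closed, `IsEpsUnstable.anti`).
[cite: BlasiakChurchCohnGrochowNaslundSawinUmans2017, Thm. 4.10 (proof)] -/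
theorem isEpsUnstable_of_lt_instability {X : Type v₁} {Y : Type v₂} {Z : Type v₃}
    [Fintype X] [Fintype Y] [Fintype Z] {F : X → Y → Z → K} {ε : ℝ}
    (hlt : (ε : EReal) < instability F) : IsEpsUnstable F ε := by
  obtain ⟨b, hb, hεb⟩ := lt_sSup_iff.1 hlt
  obtain ⟨ε', ⟨-, hε'⟩, rfl⟩ := hb
  exact hε'.anti (EReal.coe_lt_coe_iff.1 hεb).le

/-- **BCCGNSU 2017, Theorem 4.10 in its printed form** (the exponent carries `instability(F)`
itself): for every real `s ≥ 0` with `s ≤ instability(F)` and every `n ≥ 1`,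
`slicerank(F^{⊗n}) ≤ (|X|ⁿ + |Y|ⁿ + |Z|ⁿ) e^{−2ns²}`. Taking `s = instability(F)` when this
supremum is a (finite, nonnegative) real is exactly the printed statement
"`slicerank(F^{⊗n}) ≤ (|X|ⁿ+|Y|ⁿ+|Z|ⁿ)e^{−2n·instability(F)²}`"; when `instability(F) = +∞` the
bound holds for every `s`, so `slicerank(F^{⊗n}) = 0` (as `e^{−∞} = 0` in print). Proof as
printed: the bound holds for every admissible `ε < s` (`isEpsUnstable_of_lt_instability`,
`sliceRank_kroneckerPow_le_of_isEpsUnstable`) and its right-hand side is continuous in `ε`.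
[cite: BlasiakChurchCohnGrochowNaslundSawinUmans2017, Thm. 4.10] -/
theorem sliceRank_kroneckerPow_le_exp_instability {X : Type v₁} {Y : Type v₂} {Z : Type v₃}
    [Fintype X] [Fintype Y] [Fintype Z] (F : X → Y → Z → K) {s : ℝ} (hs0 : 0 ≤ s)
    (hs : (s : EReal) ≤ instability F) (n : ℕ) (hn : 1 ≤ n) :
    (sliceRank (kroneckerPow F n) : ℝ) ≤
      ((Fintype.card X : ℝ) ^ n + (Fintype.card Y : ℝ) ^ n + (Fintype.card Z : ℝ) ^ n) *
        Real.exp (-2 * n * s ^ 2) := by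
  classical
  set C : ℝ := (Fintype.card X : ℝ) ^ n + (Fintype.card Y : ℝ) ^ n + (Fintype.card Z : ℝ) ^ n
    with hC
  -- the bound for every `ε ∈ [0, s)`
  have hbound : ∀ ε, 0 ≤ ε → ε < s →
      (sliceRank (kroneckerPow F n) : ℝ) ≤ C * Real.exp (-2 * n * ε ^ 2) := by
    intro ε hε hεs
    have hlt : (ε : EReal) < instability F := lt_of_lt_of_le (EReal.coe_lt_coe_iff.2 hεs) hs
    exact sliceRank_kroneckerPow_le_of_isEpsUnstable F hε (isEpsUnstable_of_lt_instability hlt) n hn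
  rcases hs0.eq_or_lt with rfl | hs_pos
  · -- `s = 0`: the trivial bound `slicerank ≤ |Xⁿ| = |X|ⁿ`
    have h1 : (sliceRank (kroneckerPow F n) : ℝ) ≤ (Fintype.card X : ℝ) ^ n := by
      have h := sliceRank_le_card (kroneckerPow F n)
      rw [Fintype.card_fun, Fintype.card_fin] at h
      exact_mod_cast h
    have h2 : (0 : ℝ) ≤ (Fintype.card Y : ℝ) ^ n := by positivity
    have h3 : (0 : ℝ) ≤ (Fintype.card Z : ℝ) ^ n := by positivity
    have he : Real.exp (-2 * n * (0 : ℝ) ^ 2) = 1 := by simp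
    rw [he, mul_one]
    linarith
  · -- `s > 0`: let `ε ↑ s`
    have hcont : Filter.Tendsto (fun ε : ℝ => C * Real.exp (-2 * n * ε ^ 2))
        (nhdsWithin s (Set.Iio s)) (nhds (C * Real.exp (-2 * n * s ^ 2))) := by
      have hc : Continuous fun ε : ℝ => C * Real.exp (-2 * n * ε ^ 2) := by fun_prop
      exact (hc.tendsto s).mono_left nhdsWithin_le_nhds
    refine ge_of_tendsto hcont ?_
    filter_upwards [Ioo_mem_nhdsLT hs_pos] with ε hε
    exact hbound ε hε.1.le hε.2

/-- The case `instability(F) = +∞` of the printed Thm. 4.10 (`e^{−2n·∞} = 0`): then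
`slicerank(F^{⊗n}) = 0` for every `n ≥ 1` (the bound of `sliceRank_kroneckerPow_le_exp_instability`
holds for every real `s ≥ 0`, and its right-hand side tends to `0`).
[cite: BlasiakChurchCohnGrochowNaslundSawinUmans2017, Thm. 4.10] -/
theorem sliceRank_kroneckerPow_eq_zero_of_instability_eq_top {X : Type v₁} {Y : Type v₂}
    {Z : Type v₃} [Fintype X] [Fintype Y] [Fintype Z] (F : X → Y → Z → K)
    (htop : instability F = ⊤) (n : ℕ) (hn : 1 ≤ n) : sliceRank (kroneckerPow F n) = 0 := by
  set C : ℝ := (Fintype.card X : ℝ) ^ n + (Fintype.card Y : ℝ) ^ n + (Fintype.card Z : ℝ) ^ n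
    with hC
  have hC0 : 0 ≤ C := by positivity
  set s : ℝ := C + 1 with hs
  have hs1 : 1 ≤ s := by rw [hs]; linarith
  have hb := sliceRank_kroneckerPow_le_exp_instability F (s := s) (by linarith)
    (by rw [htop]; exact le_top) n hn
  have hn1 : (1 : ℝ) ≤ n := by exact_mod_cast hn
  have ht : 0 < 1 + 2 * (n : ℝ) * s ^ 2 := by positivity
  -- `e^{-t} ≤ 1/(1+t)` and `C < 1 + 2ns²`
  have hexp : Real.exp (-2 * n * s ^ 2) ≤ 1 / (1 + 2 * n * s ^ 2) := by
    have h := Real.add_one_le_exp (2 * n * s ^ 2)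
    rw [show -2 * (n : ℝ) * s ^ 2 = -(2 * n * s ^ 2) by ring, Real.exp_neg, ← one_div]
    exact one_div_le_one_div_of_le ht (by linarith)
  have hlt : C * Real.exp (-2 * n * s ^ 2) < 1 := by
    calc C * Real.exp (-2 * n * s ^ 2) ≤ C * (1 / (1 + 2 * n * s ^ 2)) :=
          mul_le_mul_of_nonneg_left hexp hC0
      _ < 1 := by
          rw [mul_one_div, div_lt_one ht]
          nlinarith
  have h1 : (sliceRank (kroneckerPow F n) : ℝ) < 1 := hb.trans_lt hlt
  have h2 : sliceRank (kroneckerPow F n) < 1 := by exact_mod_cast h1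
  omega

end Thm410Proof

end Literature.Computability.AlgebraicComplexity
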